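import Literature.Algebra.EuclideanLattices.GaussianLatticeTails
import Literature.Algebra.EuclideanLattices.SuccessiveMinimaMinNormPos
import Mathlib.Topology.Semicontinuity.Basic
import HarnessLib

/-!
# The smoothing parameter is well defined: discharges of the four basic facts of `DiscreteGaussian.lean`

Topic `Algebra/EuclideanLattices` (family `pqc`; serves the decomposition of Micciancio–Regev 2007,
Thm. 5.23 = `Literature.Computability.Cryptography.MicciancioRegev2007_gapCVP'_to_SIS'`, whose
NO-case analysis (authors' version pp. 29–31, eqs. (15)–(20)) runs on the smoothing parameter
`η_ε` through MR07 Lemma 3.2, Lemma 4.2, Lemma 4.4 and Cor. 4.6). Everything here is PROVED;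
theorems only.

Notation: `ρ_s = gaussianFunction s`, `ρ_{s,c}(A) = gaussianMass s c A` (`ℝ≥0∞`), `L* = dualLattice L`,
`η_ε(L) = smoothingParameter L ε = inf {s > 0 | ρ_{1/s}(L* ∖ {0}) ≤ ε}` (`DiscreteGaussian.lean`,
Micciancio–Regev 2007, Def. 3.1).

## Results (all for a full-rank lattice `L` of a finite-dimensional real inner product space)

* `smoothingSet_nonempty` — for `ε > 0` the defining set of `η_ε(L)` is nonempty:
  `ρ_{1/s}(L* ∖ {0}) → 0` as `s → ∞` (MR07 §3, remark after Def. 3.1), here by the explicit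
  comparison `ρ_{1/s}(A) ≤ e^{-πλ²(s² - s₀²)} ρ_{1/s₀}(A)` for a set `A` of vectors of norm `≥ λ`
  (`gaussianMass_one_div_le_exp_mul`) with `λ = λ₁(L*) > 0`.
* DISCHARGES (D-0014) of the four named facts of `DiscreteGaussian.lean`:
  `le_smoothingParameter_iff_holds` (lower bounds of the infimum),
  `gaussianMass_dual_le_of_smoothingParameter_lt_holds` (`η_ε < s ⇒ ρ_{1/s}(L* ∖ {0}) ≤ ε`,
  monotonicity), `gaussianMass_dual_smoothingParameter_le_holds` (the infimum is attained:
  `ρ_{1/η_ε}(L* ∖ {0}) ≤ ε`, by LOWER SEMICONTINUITY of `s ↦ ρ_{1/s}(A)` — a sum of nonnegative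
  continuous functions — instead of MR07's continuity remark), and `smoothingParameter_pos_holds`
  (`0 < η_ε(L)` in a nontrivial space, for EVERY `ε > 0`: by the Poisson identity
  `ρ_σ(L*) = vol(L*)⁻¹ σⁿ ρ_{1/σ}(L) ≥ vol(L*)⁻¹ σⁿ` (`GaussianLatticeSums.lean`), a parameter `s`
  in the defining set satisfies `vol(L*)⁻¹ s⁻ⁿ ≤ 1 + ε`, i.e. `s ≥ (vol(L*)(1+ε))^{-1/n} > 0` —
  this replaces MR07's "`ρ_{1/s}(Λ* ∖ {0}) → ∞` as `s → 0`").
* `gaussianMass_dual_le_of_smoothingParameter_le` — the form used downstream: `0 < s`, `η_ε ≤ s ⇒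
  ρ_{1/s}(L* ∖ {0}) ≤ ε`.

The sequel `SmoothingParameterBounds.lean` proves MR07 Lemma 3.2 (`η_{2⁻ⁿ}(L) ≤ √n/λ₁(L*)`) and the
mass estimate `ρ_{s,c}(L) ∈ (1 ± ε) sⁿ/vol(L)` for `s ≥ η_ε(L)` (Regev 2009 Claim 3.8, the engine of
MR07 Lemmas 4.1–4.4), discharging the corresponding facts of `PQCDiscreteGaussian.lean`.

## References

* D. Micciancio, O. Regev, *Worst-case to average-case reductions based on Gaussian measures*,
  SIAM J. Comput. 37 (2007) 267–302, Def. 3.1 and the remark following it (authors' version p. 10).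
* W. Banaszczyk, *New bounds in some transference theorems in the geometry of numbers*,
  Math. Ann. 296 (1993) 625–635, Lemma 1.1 (Poisson identity).
-/

noncomputable section

open MeasureTheory Module Metric Filter
open scoped Real ENNReal InnerProductSpace Topology

namespace Literature.Algebra.EuclideanLattices

section General

variable {F : Type*} [NormedAddCommGroup F]

/-- `ρ_{1/s}(x) = exp(-π ‖x‖² s²)` for every real `s` (including the junk value `s = 0`, where both
sides are `1`). [cite: MicciancioRegev2007, Def. 3.1] -/
theorem gaussianFunction_one_div (s : ℝ) (x : F) :
    gaussianFunction (1 / s) x = Real.exp (-π * ‖x‖ ^ 2 * s ^ 2) := by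
  rw [gaussianFunction, one_div, inv_pow, div_eq_mul_inv, inv_inv]

/-- The dual Gaussian weight `s ↦ ρ_{1/s}(x)` is continuous in the parameter. [folklore] -/
theorem continuous_gaussianFunction_one_div (x : F) : Continuous fun s : ℝ ↦ gaussianFunction (1 / s) x := by
  simp only [gaussianFunction_one_div]
  fun_prop

/-- Comparison of dual Gaussian masses in the parameter, with a gap: if every vector of `A` has norm
at least `l ≥ 0` and `0 ≤ s₀ ≤ s`, then `ρ_{1/s}(A) ≤ e^{-π l² (s² - s₀²)} ρ_{1/s₀}(A)` (termwise:
`e^{-π‖w‖²s²} = e^{-π‖w‖²(s²-s₀²)} e^{-π‖w‖²s₀²}` and `‖w‖ ≥ l`). This quantifies MR07's remark that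
`ρ_{1/s}(Λ* ∖ {0})` is decreasing to `0` (§3, after Def. 3.1). [cite: MicciancioRegev2007, §3 remark after Def. 3.1] -/
theorem gaussianMass_one_div_le_exp_mul {A : Set F} {l : ℝ} (hl : 0 ≤ l) (hA : ∀ w ∈ A, l ≤ ‖w‖)
    {s₀ s : ℝ} (hs₀ : 0 ≤ s₀) (h : s₀ ≤ s) :
    gaussianMass (1 / s) 0 A ≤
      ENNReal.ofReal (Real.exp (-π * l ^ 2 * (s ^ 2 - s₀ ^ 2))) * gaussianMass (1 / s₀) 0 A := by
  rw [gaussianMass, gaussianMass, ← ENNReal.tsum_mul_left]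
  refine ENNReal.tsum_le_tsum fun w ↦ ?_
  rw [← ENNReal.ofReal_mul (Real.exp_pos _).le, sub_zero, gaussianFunction_one_div, gaussianFunction_one_div,
    ← Real.exp_add]
  refine ENNReal.ofReal_le_ofReal (Real.exp_le_exp.2 ?_)
  have hw : l ^ 2 ≤ ‖(w : F)‖ ^ 2 := pow_le_pow_left₀ hl (hA w w.2) 2
  have hss : 0 ≤ s ^ 2 - s₀ ^ 2 := sub_nonneg.2 (pow_le_pow_left₀ hs₀ h 2)
  nlinarith [Real.pi_pos, mul_le_mul_of_nonneg_right hw hss]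

/-- Splitting off the origin: for a `ℤ`-submodule `Λ` (which contains `0`),
`ρ_{s,c}(Λ) = ρ_s(c) + ρ_{s,c}(Λ ∖ {0})`. [cite: MicciancioRegev2007, Def. 3.1] -/
theorem gaussianMass_eq_add_sdiff_zero (Λ : Submodule ℤ F) (s : ℝ) (c : F) :
    gaussianMass s c (Λ : Set F) = ENNReal.ofReal (gaussianFunction s c) + gaussianMass s c ((Λ : Set F) \ {0}) := by
  have hU : ({0} : Set F) ∪ ((Λ : Set F) \ {0}) = (Λ : Set F) :=
    Set.union_sdiff_cancel (Set.singleton_subset_iff.2 Λ.zero_mem)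
  rw [gaussianMass, gaussianMass, ← tsum_congr_set_coe (fun x : F ↦ ENNReal.ofReal (gaussianFunction s (x - c))) hU,
    ENNReal.summable.tsum_union_disjoint (f := fun x : F ↦ ENNReal.ofReal (gaussianFunction s (x - c)))
      Set.disjoint_sdiff_right ENNReal.summable,
    tsum_singleton (f := fun x : F ↦ ENNReal.ofReal (gaussianFunction s (x - c))), zero_sub, gaussianFunction_neg]

/-- In the zero space the punctured dual lattice is empty. [folklore] -/
theorem dualLattice_sdiff_zero_eq_empty [InnerProductSpace ℝ F] [Subsingleton F] (Λ : Submodule ℤ F) :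
    (dualLattice Λ : Set F) \ {0} = ∅ :=
  Set.eq_empty_of_forall_notMem fun x hx ↦ hx.2 (Subsingleton.elim x 0)

/-- The Gaussian mass of the empty set is `0`. [folklore] -/
theorem gaussianMass_empty (s : ℝ) (c : F) : gaussianMass s c (∅ : Set F) = 0 := by
  rw [gaussianMass, tsum_empty]

end General

section FullRank

variable {F : Type*} [NormedAddCommGroup F] [InnerProductSpace ℝ F] [FiniteDimensional ℝ F]
variable (L : Submodule ℤ F) [DiscreteTopology L] [IsZLattice ℝ L]

/-- The nonzero vectors of the dual of a full-rank lattice are bounded away from `0`: there is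
`l > 0` with `‖w‖ ≥ l` for all `w ∈ L* ∖ {0}` (`l = λ₁(L*)` when the space is nontrivial; vacuous in
the zero space). [folklore] -/
theorem exists_pos_forall_dual_le_norm :
    ∃ l : ℝ, 0 < l ∧ ∀ w ∈ (dualLattice L : Set F) \ {0}, l ≤ ‖w‖ := by
  by_cases hbot : dualLattice L = ⊥
  · refine ⟨1, one_pos, fun w hw ↦ ?_⟩
    exact absurd ((Submodule.mem_bot ℤ).1 (hbot ▸ hw.1 : w ∈ (⊥ : Submodule ℤ F))) hw.2
  · refine ⟨minNorm (dualLattice L), minNorm_pos_of_ne_bot _ hbot, fun w hw ↦ ?_⟩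
    exact csInf_le ⟨0, by rintro _ ⟨x, -, rfl⟩; exact norm_nonneg x⟩ ⟨w, ⟨hw.1, hw.2⟩, rfl⟩

/-- **The defining set of `η_ε(L)` is nonempty** for `ε > 0` (Micciancio–Regev 2007, §3, remark
after Def. 3.1: `ρ_{1/s}(Λ* ∖ {0}) → 0` as `s → ∞`, "so the parameter `η_ε(Λ)` is well defined for
any `ε > 0`"). Proof: `ρ_{1/s}(L* ∖ {0}) ≤ e^{-πλ²(s-1)} ρ_1(L* ∖ {0})` for `s ≥ 1`, `λ = λ₁(L*)`.
[cite: MicciancioRegev2007, §3 remark after Def. 3.1] -/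
theorem smoothingSet_nonempty {ε : ℝ} (hε : 0 < ε) :
    {s : ℝ | 0 < s ∧ gaussianMass (1 / s) 0 ((dualLattice L : Set F) \ {0}) ≤ ENNReal.ofReal ε}.Nonempty := by
  obtain ⟨l, hl, hA⟩ := exists_pos_forall_dual_le_norm L
  set A : Set F := (dualLattice L : Set F) \ {0} with hAdef
  have hfin : gaussianMass (1 / 1) 0 A ≠ ∞ :=
    ne_top_of_le_ne_top (gaussianMass_lattice_ne_top (dualLattice L) (by norm_num) 0)
      (gaussianMass_mono _ _ Set.sdiff_subset)
  set M : ℝ := (gaussianMass (1 / 1) 0 A).toReal with hM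
  have hM0 : 0 ≤ M := ENNReal.toReal_nonneg
  set μ : ℝ := max 0 (Real.log (M / ε)) with hμ
  have hμ0 : 0 ≤ μ := le_max_left _ _
  set s : ℝ := 1 + μ / (π * l ^ 2) with hs
  have hπl : 0 < π * l ^ 2 := by positivity
  have hs1 : 1 ≤ s := le_add_of_nonneg_right (div_nonneg hμ0 hπl.le)
  refine ⟨s, lt_of_lt_of_le one_pos hs1, ?_⟩
  have hcmp := gaussianMass_one_div_le_exp_mul hl.le hA zero_le_one hs1
  -- `e^{-π l² (s² - 1)} ≤ e^{-π l² (s - 1)} = e^{-μ}`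
  have hexp : Real.exp (-π * l ^ 2 * (s ^ 2 - 1 ^ 2)) ≤ Real.exp (-μ) := by
    refine Real.exp_le_exp.2 ?_
    have h1 : s - 1 ≤ s ^ 2 - 1 ^ 2 := by nlinarith
    have h2 : π * l ^ 2 * (s - 1) = μ := by
      rw [hs]; field_simp; ring
    nlinarith [mul_le_mul_of_nonneg_left h1 hπl.le]
  have hexpM : Real.exp (-μ) * M ≤ ε := by
    rcases hM0.eq_or_lt with hM00 | hMpos
    · rw [← hM00, mul_zero]; exact hε.le
    · have hlog : Real.log (M / ε) ≤ μ := le_max_right _ _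
      have : Real.exp (-μ) ≤ ε / M := by
        rw [Real.exp_neg, inv_le_comm₀ (Real.exp_pos _) (div_pos hε hMpos), inv_div]
        calc M / ε = Real.exp (Real.log (M / ε)) := (Real.exp_log (div_pos hMpos hε)).symm
          _ ≤ Real.exp μ := Real.exp_le_exp.2 hlog
      calc Real.exp (-μ) * M ≤ ε / M * M := mul_le_mul_of_nonneg_right this hM0
        _ = ε := div_mul_cancel₀ ε hMpos.ne'
  calc gaussianMass (1 / s) 0 A
      ≤ ENNReal.ofReal (Real.exp (-π * l ^ 2 * (s ^ 2 - 1 ^ 2))) * gaussianMass (1 / 1) 0 A := hcmp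
    _ ≤ ENNReal.ofReal (Real.exp (-μ)) * ENNReal.ofReal M := by
        rw [hM, ENNReal.ofReal_toReal hfin]
        gcongr
    _ = ENNReal.ofReal (Real.exp (-μ) * M) := (ENNReal.ofReal_mul (Real.exp_pos _).le).symm
    _ ≤ ENNReal.ofReal ε := ENNReal.ofReal_le_ofReal hexpM

omit [FiniteDimensional ℝ F] [DiscreteTopology L] [IsZLattice ℝ L] in
/-- The defining set of `η_ε(L)` is bounded below (by `0`). [cite: MicciancioRegev2007, Def. 3.1] -/
theorem smoothingSet_bddBelow (ε : ℝ) :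
    BddBelow {s : ℝ | 0 < s ∧ gaussianMass (1 / s) 0 ((dualLattice L : Set F) \ {0}) ≤ ENNReal.ofReal ε} :=
  ⟨0, fun _ hs ↦ hs.1.le⟩

omit [InnerProductSpace ℝ F] [FiniteDimensional ℝ F] in
/-- The dual mass `s ↦ ρ_{1/s}(A)` is lower semicontinuous in the parameter (a sum of nonnegative
continuous functions). [folklore] -/
theorem lowerSemicontinuous_gaussianMass_one_div (A : Set F) :
    LowerSemicontinuous fun s : ℝ ↦ gaussianMass (1 / s) 0 A := by
  change LowerSemicontinuous fun s : ℝ ↦ ∑' x : A, ENNReal.ofReal (gaussianFunction (1 / s) ((x : F) - 0))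
  refine lowerSemicontinuous_tsum fun x ↦ Continuous.lowerSemicontinuous ?_
  exact ENNReal.continuous_ofReal.comp (continuous_gaussianFunction_one_div ((x : F) - 0))

end FullRank

/-! ### The four discharges -/

section Discharges

variable {F : Type*} [NormedAddCommGroup F] [InnerProductSpace ℝ F] (L : Submodule ℤ F)

/-- **Discharge of `le_smoothingParameter_iff`** (Micciancio–Regev 2007, Def. 3.1): for `0 < ε` and
a full-rank lattice, `t ≤ η_ε(L)` iff `t ≤ s` for every `s > 0` with `ρ_{1/s}(L* ∖ {0}) ≤ ε` — the
defining set is nonempty (`smoothingSet_nonempty`) and bounded below. [cite: MicciancioRegev2007, Def. 3.1] -/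
theorem le_smoothingParameter_iff_holds : le_smoothingParameter_iff L := by
  intro _ _ _ ε hε t
  rw [smoothingParameter, le_csInf_iff (smoothingSet_bddBelow L ε) (smoothingSet_nonempty L hε)]
  simp only [Set.mem_setOf_eq, and_imp]

/-- **Discharge of `gaussianMass_dual_le_of_smoothingParameter_lt`** (Micciancio–Regev 2007,
Def. 3.1 with the monotonicity of `s ↦ ρ_{1/s}`): if `η_ε(L) < s` then `ρ_{1/s}(L* ∖ {0}) ≤ ε` —
some `s' < s` lies in the defining set, and the mass at `s` is at most the mass at `s'`.
[cite: MicciancioRegev2007, Def. 3.1] -/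
theorem gaussianMass_dual_le_of_smoothingParameter_lt_holds :
    gaussianMass_dual_le_of_smoothingParameter_lt L := by
  intro _ _ _ ε s hε hs
  obtain ⟨s', hs'S, hs's⟩ := exists_lt_of_csInf_lt (smoothingSet_nonempty L hε) hs
  exact (gaussianMass_dual_antitone L hs'S.1 (hs'S.1.trans hs's) hs's.le).trans hs'S.2

/-- **Discharge of `gaussianMass_dual_smoothingParameter_le`** (Micciancio–Regev 2007, Def. 3.1:
the infimum is attained, `ρ_{1/η_ε(L)}(L* ∖ {0}) ≤ ε`). Proof: `s ↦ ρ_{1/s}(L* ∖ {0})` is lower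
semicontinuous; if its value at `η_ε` exceeded `ε` it would exceed `ε` at some `s > η_ε`,
contradicting `gaussianMass_dual_le_of_smoothingParameter_lt`. [cite: MicciancioRegev2007, Def. 3.1] -/
theorem gaussianMass_dual_smoothingParameter_le_holds : gaussianMass_dual_smoothingParameter_le L := by
  intro _ _ _ ε hε
  by_contra h
  push Not at h
  set A : Set F := (dualLattice L : Set F) \ {0}
  have hlsc := lowerSemicontinuous_gaussianMass_one_div A (smoothingParameter L ε) _ h
  obtain ⟨s, hs1, hs2⟩ :=
    ((hlsc.filter_mono (nhdsWithin_le_nhds (s := Set.Ioi (smoothingParameter L ε)))).and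
      eventually_mem_nhdsWithin).exists
  exact absurd (gaussianMass_dual_le_of_smoothingParameter_lt_holds L hε hs2) (not_le.2 hs1)

/-- The form used downstream: for `0 < ε`, `0 < s` and `η_ε(L) ≤ s`, `ρ_{1/s}(L* ∖ {0}) ≤ ε`
(Micciancio–Regev 2007, Def. 3.1: either `η_ε < s`, or `s = η_ε` and the infimum is attained).
[cite: MicciancioRegev2007, Def. 3.1] -/
theorem gaussianMass_dual_le_of_smoothingParameter_le [FiniteDimensional ℝ F] [DiscreteTopology L]
    [IsZLattice ℝ L] {ε s : ℝ} (hε : 0 < ε) (hηs : smoothingParameter L ε ≤ s) :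
    gaussianMass (1 / s) 0 ((dualLattice L : Set F) \ {0}) ≤ ENNReal.ofReal ε := by
  rcases hηs.lt_or_eq with hlt | heq
  · exact gaussianMass_dual_le_of_smoothingParameter_lt_holds L hε hlt
  · rw [← heq]
    exact gaussianMass_dual_smoothingParameter_le_holds L hε

/-- **Discharge of `smoothingParameter_pos`** (Micciancio–Regev 2007, §3: `η_ε(Λ) > 0`, there via
`ρ_{1/s}(Λ* ∖ {0}) → ∞` as `s → 0⁺`). Proof here, for every `ε > 0` in a nontrivial space of
dimension `n ≥ 1`: by the Poisson identity for the full lattice `L*`,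
`1 + ρ_{1/s}(L* ∖ {0}) = ρ_{1/s}(L*) = vol(L*)⁻¹ s⁻ⁿ ρ_s(L**) ≥ vol(L*)⁻¹ s⁻ⁿ`, so every `s` in the
defining set satisfies `sⁿ ≥ (vol(L*)(1 + ε))⁻¹`, whence `η_ε(L) ≥ (vol(L*)(1 + ε))^{-1/n} > 0`.
[cite: MicciancioRegev2007, §3 remark after Def. 3.1; Banaszczyk1993 Lemma 1.1] -/
theorem smoothingParameter_pos_holds : smoothingParameter_pos L := by
  intro _ _ _ _ ε hε
  borelize F
  set n : ℕ := finrank ℝ F with hn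
  have hn0 : n ≠ 0 := (Module.finrank_pos (R := ℝ) (M := F)).ne'
  set Λ : Submodule ℤ F := dualLattice L with hΛ
  have hcov : 0 < ZLattice.covolume Λ := ZLattice.covolume_pos Λ volume
  set c : ℝ := ((ZLattice.covolume Λ * (1 + ε))⁻¹) ^ ((n : ℝ)⁻¹) with hc
  have hK : 0 < (ZLattice.covolume Λ * (1 + ε))⁻¹ := by positivity
  have hc0 : 0 < c := Real.rpow_pos_of_pos hK _
  refine lt_of_lt_of_le hc0 (le_csInf (smoothingSet_nonempty L hε) ?_)
  rintro s ⟨hs0, hsm⟩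
  have hσ : 0 < s⁻¹ := inv_pos.2 hs0
  -- the real Gaussian sum over `Λ = L*` with parameter `σ = 1/s`
  set P : ℝ := ∑' y : Λ, gaussianFunction s⁻¹ (y : F) with hP
  -- (i) `P ≤ 1 + ε`
  have hPle : P ≤ 1 + ε := by
    have h1 : ENNReal.ofReal P = gaussianMass s⁻¹ 0 (Λ : Set F) := by
      rw [gaussianMass_coe_eq_ofReal_tsum Λ hσ.ne' 0]
      simp only [sub_zero, hP]
    have h2 : gaussianMass s⁻¹ 0 (Λ : Set F) ≤ ENNReal.ofReal (1 + ε) := by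
      rw [gaussianMass_eq_add_sdiff_zero Λ s⁻¹ 0, gaussianFunction_zero, ENNReal.ofReal_add zero_le_one hε.le,
        ENNReal.ofReal_one]
      gcongr
      rwa [← one_div]
    exact (ENNReal.ofReal_le_ofReal_iff (by positivity)).1 (h1 ▸ h2)
  -- (ii) `vol(Λ)⁻¹ σⁿ ≤ P`
  have hPge : (ZLattice.covolume Λ)⁻¹ * s⁻¹ ^ n ≤ P := by
    rw [hP, tsum_gaussianFunction_eq Λ hσ]
    have hS : Summable fun w : dualLattice Λ ↦ gaussianFunction s⁻¹⁻¹ (w : F) :=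
      (summable_gaussianFunction_sub (dualLattice Λ) (inv_ne_zero hσ.ne') (0 : F)).congr fun w ↦ by rw [sub_zero]
    have h1 : (1 : ℝ) ≤ ∑' w : dualLattice Λ, gaussianFunction s⁻¹⁻¹ (w : F) := by
      have := hS.le_tsum ⟨0, (dualLattice Λ).zero_mem⟩ fun w _ ↦ (gaussianFunction_pos _ _).le
      simpa using this
    have hc' : 0 ≤ (ZLattice.covolume Λ)⁻¹ * s⁻¹ ^ n := by positivity
    have := mul_le_mul_of_nonneg_left h1 hc'
    rwa [mul_one] at this
  -- (iii) `sⁿ ≥ (vol(Λ)(1+ε))⁻¹ = cⁿ`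
  have hsn : (ZLattice.covolume Λ * (1 + ε))⁻¹ ≤ s ^ n := by
    have h := hPge.trans hPle
    rw [inv_pow, inv_mul_le_iff₀ hcov] at h
    exact inv_le_of_inv_le₀ (pow_pos hs0 n) h
  have hcn : c ^ n = (ZLattice.covolume Λ * (1 + ε))⁻¹ := by
    rw [hc, Real.rpow_inv_natCast_pow hK.le hn0]
  exact le_of_pow_le_pow_left₀ hn0 hs0.le (hcn ▸ hsn)

end Discharges

end Literature.Algebra.EuclideanLattices

end
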